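import Mathlib
import Summits.NavierStokesRegularity.NavierStokesRegularity.Theorems.EulerZoomLiouvillePowerGaugeEulerLiouvilleWeakTraceLaw
import HarnessLib

/-!
# THE WEAK TRACE LAW FOR ALL TEST FIELDS: the scale-derivative identity with pressure (t59-TR(b)) and the law under the pressure budget (t59-TR(c))
# (nsreg-p2 ROUND-54 «THE TRACE», r54/Sketch54.lean f78682d2f4ee3f27: `NsregP2.R54.Trace.TraceDerivativeIdentity ρ V` and `NsregP2.R54.Trace.WeakTraceLaw ρ V` VERBATIM;
# seat ns-ezl-w3 g8, `--supports stmt-NavierStokesRegularity-19832 --as helper`)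

The companion of `…WeakTraceLaw.lean` (divergence-free tests).  For a GENERAL test field `ψ ∈ C¹_c(ℝ³;ℝ³)` the pressure no longer drops but enters through ONE
integration by parts, `∫⟪∇P, ψ⟫ = −∫P·div ψ`:

* `WeakTrace.weakProfileIdentity_pressure` — `(1 − 4γ)∫⟪V, ψ⟫ = ∫⟪V, Dψ[γy + V]⟫ + ∫P·div ψ` for every `ψ ∈ C¹_c` (classical profile, exponent `γ`, centre `0`);
* ★ `WeakTrace.traceDerivativeIdentity (hρ : 2 + ρ ≠ 0) (V)` = `NsregP2.R54.Trace.TraceDerivativeIdentity ρ V` VERBATIM (t59-TR(b)):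
  `d/dl (l^{ρ−2}∫⟪V y, g(l⁻¹y)⟫) = (2+ρ)·l^{ρ−4}·∫ [⟪V z, Dg(l⁻¹z)[V z]⟫ + P z·(div g)(l⁻¹z)] dz` for every `g ∈ C¹_c`, `l > 0` — the linear terms cancel
  EXACTLY (`(1−4γ)/γ = ρ − 2`);
* ★ `WeakTrace.weakTraceLaw_allTests (hρ : -2 < ρ) (V)` = `NsregP2.R54.Trace.WeakTraceLaw ρ V` VERBATIM (t59-TR(c)): under the `A`-gauge budget AND the pressure budget
  `∫_{B_R}|P| ≤ D·R^{1−2ρ}` (`R ≥ 1`) the scaled pairing converges against EVERY `C¹_c` test field with rate `l^{−(2+ρ)}`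
  (`|F′(l)| ≤ (2+ρ)(B₁A + B₂D)r^{1−2ρ}·l^{−3−ρ}`, `B₂ = sup‖div g‖`; ns-sfl-p1 g9's `TwoSidedMoment.exists_limit_of_deriv_bound`).

HONEST FRAMING: portrait instruments about HYPOTHETICAL profiles (the blow-up-time trace as a functional on test fields, GIVEN the pressure budget; the budget itself =
pressure slaving, not proved here); nothing about the crux E (`PowerGaugeEulerLiouville`, stmt 19832, OPEN) or NS regularity is proved; MODEL-lattice crux class; not E.
[nsreg-p2 R54 §B; cite: Leray1934, §6 (1.11) p. 203 (the IBP); folklore]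
-/

noncomputable section

set_option linter.dupNamespace false

open MeasureTheory Set Filter Topology Metric Function TopologicalSpace
open scoped ENNReal NNReal RealInnerProductSpace Topology

namespace Summit.NavierStokesRegularity.NavierStokesRegularity.Theorems.PowerGaugeEulerLiouville

open Literature.Analysis Literature.Analysis.FluidPDE

namespace WeakTrace

variable {V : EuclideanSpace ℝ (Fin 3) → EuclideanSpace ℝ (Fin 3)} {ρ : ℝ} {P : EuclideanSpace ℝ (Fin 3) → ℝ}

/-- The divergence vanishes where the derivative does. [folklore] -/
theorem divergence_eq_zero_of_fderiv_eq_zero {g : EuclideanSpace ℝ (Fin 3) → EuclideanSpace ℝ (Fin 3)} {x : EuclideanSpace ℝ (Fin 3)}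
    (h : fderiv ℝ g x = 0) : VectorCalculus.divergence g x = 0 := by
  unfold VectorCalculus.divergence
  rw [h]
  simp

/-- **THE WEAK PROFILE IDENTITY WITH PRESSURE** (every test field): for a classical self-similar Euler profile `(V, P)` with exponent `γ` and centre `0` and every
`ψ ∈ C¹_c(ℝ³;ℝ³)`: `(1 − 4γ)·∫⟪V, ψ⟫ = ∫⟪V(y), Dψ(y)[γy + V(y)]⟫ + ∫ P·div ψ` — the profile equation paired with `ψ`, the transport derivative moved onto `ψ`
(trilinear identity, `div(γy + V) = 3γ`) and the pressure through `∫⟪∇P, ψ⟫ = −∫P·div ψ`. [cite: Leray1934, §6 (1.11) p. 203; nsreg-p2 R54 §B] -/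
theorem weakProfileIdentity_pressure {γ : ℝ} (hprof : IsSelfSimilarEulerProfile γ 0 V P)
    {ψ : EuclideanSpace ℝ (Fin 3) → EuclideanSpace ℝ (Fin 3)} (hψ : ContDiff ℝ 1 ψ) (hψc : HasCompactSupport ψ) :
    (1 - 4 * γ) * ∫ y, ⟪V y, ψ y⟫ =
      (∫ y, ⟪V y, fderiv ℝ ψ y (γ • y + V y)⟫) + ∫ y, P y * VectorCalculus.divergence ψ y := by
  have hV2 : ContDiff ℝ 2 V := hprof.contDiff_velocity
  have hV1 : ContDiff ℝ 1 V := hV2.of_le one_le_two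
  have hVd : Differentiable ℝ V := hprof.differentiable_velocity
  have hP1 : ContDiff ℝ 1 P := hprof.contDiff_pressure
  set W : EuclideanSpace ℝ (Fin 3) → EuclideanSpace ℝ (Fin 3) := selfSimilarTransport γ 0 V with hWdef
  have hWapply : ∀ y, W y = γ • y + V y := fun y => by rw [hWdef, selfSimilarTransport_apply, sub_zero]
  have hW1 : ContDiff ℝ 1 W := by
    have : W = fun y => γ • (y - 0) + V y := by funext y; rw [hWdef, selfSimilarTransport_apply]
    rw [this]
    exact ((contDiff_id.sub contDiff_const).const_smul γ).add hV1
  have hdivW : ∀ y, VectorCalculus.divergence W y = 3 * γ := fun y =>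
    divergence_selfSimilarTransport hVd hprof.divFree y
  have hpt : ∀ y, ⟪(1 - γ) • V y + convect W V y + gradient P y, ψ y⟫ = 0 := fun y => by
    have h := hprof.profile_eq y
    rw [convect, hWapply, ← sub_zero y]
    simp only [sub_zero] at h ⊢
    rw [h, inner_zero_left]
  have hψcont : Continuous ψ := hψ.continuous
  have hsupp : ∀ {f : EuclideanSpace ℝ (Fin 3) → EuclideanSpace ℝ (Fin 3)}, Continuous f →
      Integrable (fun y => ⟪f y, ψ y⟫) := fun hf =>
    (hf.inner hψcont).integrable_of_hasCompactSupport (hψc.mono fun y hy => by contrapose! hy; simp_all)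
  have hI1 : Integrable (fun y => ⟪(1 - γ) • V y, ψ y⟫) := hsupp (hV1.continuous.fun_const_smul (1 - γ))
  have hI2 : Integrable (fun y => ⟪convect W V y, ψ y⟫) :=
    hsupp ((hV1.continuous_fderiv one_ne_zero).clm_apply hW1.continuous)
  have hI3 : Integrable (fun y => ⟪gradient P y, ψ y⟫) := hsupp (continuous_gradient_of_contDiff hP1)
  have hI12 : Integrable (fun y => ⟪(1 - γ) • V y, ψ y⟫ + ⟪convect W V y, ψ y⟫) := hI1.add hI2
  have hsum : (∫ y, ⟪(1 - γ) • V y, ψ y⟫) + (∫ y, ⟪convect W V y, ψ y⟫) + ∫ y, ⟪gradient P y, ψ y⟫ = 0 := by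
    have h0 : ∫ y, (⟪(1 - γ) • V y, ψ y⟫ + ⟪convect W V y, ψ y⟫ + ⟪gradient P y, ψ y⟫) = 0 := by
      have e : (fun y => ⟪(1 - γ) • V y, ψ y⟫ + ⟪convect W V y, ψ y⟫ + ⟪gradient P y, ψ y⟫) = fun _ => (0 : ℝ) :=
        funext fun y => by rw [← inner_add_left, ← inner_add_left]; exact hpt y
      rw [e, integral_zero]
    rw [integral_add hI12 hI3, integral_add hI1 hI2] at h0
    exact h0
  have htri := integral_inner_convect_add_eq_zero hW1 hV1 hψ hψc
  have hpress : ∫ y, ⟪gradient P y, ψ y⟫ = -∫ y, P y * VectorCalculus.divergence ψ y :=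
    integral_inner_gradient_eq_neg_integral_mul_divergence hP1 hψ hψc
  have e1 : ∫ y, ⟪(1 - γ) • V y, ψ y⟫ = (1 - γ) * ∫ y, ⟪V y, ψ y⟫ := by
    rw [← integral_const_mul]
    exact integral_congr_ae (ae_of_all _ fun y => by simp only [real_inner_smul_left])
  have e2 : ∫ y, VectorCalculus.divergence W y * ⟪V y, ψ y⟫ = 3 * γ * ∫ y, ⟪V y, ψ y⟫ := by
    rw [← integral_const_mul]
    exact integral_congr_ae (ae_of_all _ fun y => by simp only [hdivW y])
  have e3 : ∫ y, ⟪V y, convect W ψ y⟫ = ∫ y, ⟪V y, fderiv ℝ ψ y (γ • y + V y)⟫ :=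
    integral_congr_ae (ae_of_all _ fun y => by simp only [convect, hWapply])
  rw [e1, hpress] at hsum
  rw [e2, e3] at htri
  linarith

/-- ★ **t59-TR(b): `NsregP2.R54.Trace.TraceDerivativeIdentity ρ V` VERBATIM** (r54/Sketch54.lean f78682d2f4ee3f27), for `2 + ρ ≠ 0`: for a classical profile with
exponent `γ = 1/(2+ρ)`, centre `0`, every `g ∈ C¹_c` and `l > 0`,
`d/dl (l^{ρ−2}∫⟪V y, g(l⁻¹y)⟫dy) = (2+ρ)·l^{ρ−4}·∫ [⟪V z, Dg(l⁻¹z)[V z]⟫ + P z·(div g)(l⁻¹z)] dz` — differentiation under the integral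
(`hasDerivAt_dilatedPairing`), the weak profile identity with pressure at `ψ = g(l⁻¹·)` (`div ψ = l⁻¹(div g)(l⁻¹·)`), and the EXACT cancellation `(1−4γ)/γ = ρ − 2`.
[nsreg-p2 R54 §B] -/
theorem traceDerivativeIdentity (hρ : 2 + ρ ≠ 0) (V : EuclideanSpace ℝ (Fin 3) → EuclideanSpace ℝ (Fin 3)) :
    ∀ P : EuclideanSpace ℝ (Fin 3) → ℝ, IsSelfSimilarEulerProfile (1 / (2 + ρ)) 0 V P →
      ∀ g : EuclideanSpace ℝ (Fin 3) → EuclideanSpace ℝ (Fin 3), ContDiff ℝ 1 g → HasCompactSupport g → ∀ l : ℝ, 0 < l →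
        HasDerivAt (fun l' : ℝ => l' ^ (ρ - 2) * ∫ y, ⟪V y, g (l'⁻¹ • y)⟫)
          ((2 + ρ) * l ^ (ρ - 4) *
            ∫ z, (⟪V z, fderiv ℝ g (l⁻¹ • z) (V z)⟫ + P z * VectorCalculus.divergence g (l⁻¹ • z))) l := by
  intro P hprof g hg hgc l hl
  have hVc : Continuous V := hprof.contDiff_velocity.continuous
  have hPc : Continuous P := hprof.contDiff_pressure.continuous
  set γ : ℝ := 1 / (2 + ρ) with hγdef
  set G : ℝ := ∫ y, ⟪V y, g (l⁻¹ • y)⟫ with hGdef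
  set H : ℝ := ∫ y, ⟪V y, fderiv ℝ g (l⁻¹ • y) y⟫ with hHdef
  set K : ℝ := ∫ y, ⟪V y, fderiv ℝ g (l⁻¹ • y) (V y)⟫ with hKdef
  set Pr : ℝ := ∫ y, P y * VectorCalculus.divergence g (l⁻¹ • y) with hPrdef
  -- `G′(l) = −l⁻² H`
  have hG := hasDerivAt_dilatedPairing hg hgc hVc hl
  have hG' : ∫ y, ⟪V y, fderiv ℝ g (l⁻¹ • y) ((-(l ^ 2)⁻¹) • y)⟫ = -(l ^ 2)⁻¹ * H := by
    rw [hHdef, ← integral_const_mul]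
    exact integral_congr_ae (ae_of_all _ fun y => by simp only [map_smul, real_inner_smul_right])
  rw [hG'] at hG
  -- the weak identity with pressure at `ψ = g(l⁻¹·)`
  have hψ : ContDiff ℝ 1 (fun y : EuclideanSpace ℝ (Fin 3) => g (l⁻¹ • y)) := hg.comp (contDiff_const_smul l⁻¹)
  have hψc : HasCompactSupport (fun y : EuclideanSpace ℝ (Fin 3) => g (l⁻¹ • y)) := hasCompactSupport_dilate_vec hgc hl.ne'
  have hweak := weakProfileIdentity_pressure hprof hψ hψc
  -- integrability (continuous × compact support of `Dg(l⁻¹·)`, `div g(l⁻¹·)`)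
  obtain ⟨B₀, B₁, r, hB₀, hB₁, hr, hgB, hDgB, hg0, hDg0⟩ := exists_bounds_of_vectorWeight hg hgc
  have hDgc : Continuous (fderiv ℝ g) := hg.continuous_fderiv one_ne_zero
  have hsm : Continuous fun y : EuclideanSpace ℝ (Fin 3) => l⁻¹ • y := continuous_const_smul l⁻¹
  have hfar_of : ∀ {y : EuclideanSpace ℝ (Fin 3)}, r * l < ‖y‖ → r ≤ ‖l⁻¹ • y‖ := fun {y} hy => by
    rw [norm_smul, norm_inv, Real.norm_eq_abs, abs_of_pos hl, le_inv_mul_iff₀ hl]; linarith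
  have hsuppD : ∀ {w : EuclideanSpace ℝ (Fin 3) → EuclideanSpace ℝ (Fin 3)}, Continuous w →
      Integrable (fun y => ⟪V y, fderiv ℝ g (l⁻¹ • y) (w y)⟫) := by
    intro w hw
    refine ((hVc.inner ((hDgc.comp hsm).clm_apply hw)).integrable_of_hasCompactSupport ?_)
    refine HasCompactSupport.of_support_subset_isCompact (isCompact_closedBall (0 : EuclideanSpace ℝ (Fin 3)) (r * l)) fun y hy => ?_
    rw [mem_closedBall, dist_zero_right]
    by_contra hcon
    exact hy (by simp only [hDg0 _ (hfar_of (not_le.1 hcon)), zero_apply, inner_zero_right])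
  have hIH : Integrable (fun y => ⟪V y, fderiv ℝ g (l⁻¹ • y) y⟫) := hsuppD continuous_id
  have hIK : Integrable (fun y => ⟪V y, fderiv ℝ g (l⁻¹ • y) (V y)⟫) := hsuppD hVc
  have hdivc : Continuous fun y : EuclideanSpace ℝ (Fin 3) => VectorCalculus.divergence g (l⁻¹ • y) :=
    (continuous_divergence hDgc).comp hsm
  have hIPr : Integrable (fun y => P y * VectorCalculus.divergence g (l⁻¹ • y)) := by
    refine (hPc.mul hdivc).integrable_of_hasCompactSupport ?_
    refine HasCompactSupport.of_support_subset_isCompact (isCompact_closedBall (0 : EuclideanSpace ℝ (Fin 3)) (r * l)) fun y hy => ?_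
    rw [mem_closedBall, dist_zero_right]
    by_contra hcon
    refine hy ?_
    show P y * VectorCalculus.divergence g (l⁻¹ • y) = 0
    rw [divergence_eq_zero_of_fderiv_eq_zero (hDg0 _ (hfar_of (not_le.1 hcon))), mul_zero]
  -- the two right-hand sides of the weak identity at `ψ = g(l⁻¹·)`
  have hrhs1 : ∫ y, ⟪V y, fderiv ℝ (fun y : EuclideanSpace ℝ (Fin 3) => g (l⁻¹ • y)) y (γ • y + V y)⟫ = l⁻¹ * (γ * H + K) := by
    have e : ∀ y, ⟪V y, fderiv ℝ (fun y : EuclideanSpace ℝ (Fin 3) => g (l⁻¹ • y)) y (γ • y + V y)⟫ =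
        l⁻¹ * γ * ⟪V y, fderiv ℝ g (l⁻¹ • y) y⟫ + l⁻¹ * ⟪V y, fderiv ℝ g (l⁻¹ • y) (V y)⟫ := by
      intro y
      rw [fderiv_dilate_vec_apply hg]
      simp only [smul_add, map_add, map_smul, smul_smul, inner_add_right, real_inner_smul_right]
    simp_rw [e]
    rw [integral_add (hIH.const_mul _) (hIK.const_mul _), integral_const_mul, integral_const_mul]
    ring
  have hrhs2 : ∫ y, P y * VectorCalculus.divergence (fun y : EuclideanSpace ℝ (Fin 3) => g (l⁻¹ • y)) y = l⁻¹ * Pr := by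
    rw [hPrdef, ← integral_const_mul]
    exact integral_congr_ae (ae_of_all _ fun y => by beta_reduce; rw [divergence_dilate_vec hg]; ring)
  rw [hrhs1, hrhs2] at hweak
  -- product rule and the cancellation
  have hpow : HasDerivAt (fun l : ℝ => l ^ (ρ - 2)) ((ρ - 2) * l ^ (ρ - 2 - 1)) l :=
    Real.hasDerivAt_rpow_const (Or.inl hl.ne')
  have hF := hpow.mul hG
  have hsumKPr : ∫ z, (⟪V z, fderiv ℝ g (l⁻¹ • z) (V z)⟫ + P z * VectorCalculus.divergence g (l⁻¹ • z)) = K + Pr :=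
    integral_add hIK hIPr
  rw [hsumKPr]
  refine hF.congr_deriv ?_
  have hγ : γ * (2 + ρ) = 1 := by rw [hγdef]; field_simp
  have hl0 : l ≠ 0 := hl.ne'
  have hHsol : H = (2 + ρ) * (l * (1 - 4 * γ) * G - K - Pr) := by
    have h1 : (1 - 4 * γ) * G = l⁻¹ * (γ * H + K) + l⁻¹ * Pr := hweak
    have h2 : γ * H + K + Pr = l * ((1 - 4 * γ) * G) := by
      rw [h1]; field_simp
    have h3 : γ * H = l * (1 - 4 * γ) * G - K - Pr := by linarith
    calc H = (2 + ρ) * (γ * H) := by rw [← mul_assoc, mul_comm (2 + ρ) γ, hγ, one_mul]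
      _ = (2 + ρ) * (l * (1 - 4 * γ) * G - K - Pr) := by rw [h3]
  have e3 : l ^ (ρ - 2 - 1) = l ^ (ρ - 4) * l := by
    rw [show ρ - 2 - 1 = (ρ - 4) + 1 by ring, Real.rpow_add hl, Real.rpow_one]
  have e2 : l ^ (ρ - 2) = l ^ (ρ - 4) * l ^ 2 := by
    rw [show ρ - 2 = (ρ - 4) + 2 by ring, Real.rpow_add hl, Real.rpow_two]
  have e4 : l ^ (ρ - 2) * (-(l ^ 2)⁻¹ * H) = -(l ^ (ρ - 4) * H) := by
    rw [e2]; field_simp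
  have h14 : 1 - 4 * γ = γ * (ρ - 2) := by
    have : γ = 1 / (2 + ρ) := hγdef
    rw [this]; field_simp; ring
  rw [e3, e4, hHsol, h14]
  linear_combination (-(ρ - 2) * l * l ^ (ρ - 4) * G) * hγ

/-- ★ **t59-TR(c): `NsregP2.R54.Trace.WeakTraceLaw ρ V` VERBATIM** (r54/Sketch54.lean f78682d2f4ee3f27), for every `ρ > −2`: under the `A`-gauge budget and the pressure budget
`∫_{B_R}|P| ≤ D·R^{1−2ρ}` (`R ≥ 1`) the scaled pairing converges against EVERY `C¹_c` test field with rate `l^{−(2+ρ)}`: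
`|F′(l)| ≤ (2+ρ)(B₁·A + B₂·D)·r^{1−2ρ}·l^{−3−ρ}` (`B₁ = sup‖Dg‖`, `B₂ = sup|div g|`, `supp g ⊆ B̄_r`, `r ≥ 1`), then
`TwoSidedMoment.exists_limit_of_deriv_bound`. [nsreg-p2 R54 §B; folklore] -/
theorem weakTraceLaw_allTests (hρ : -2 < ρ) (V : EuclideanSpace ℝ (Fin 3) → EuclideanSpace ℝ (Fin 3)) :
    ∀ P : EuclideanSpace ℝ (Fin 3) → ℝ, IsSelfSimilarEulerProfile (1 / (2 + ρ)) 0 V P →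
      (∃ A : ℝ, ∀ R : ℝ, 1 ≤ R → ∫ y in ball (0 : EuclideanSpace ℝ (Fin 3)) R, ‖V y‖ ^ 2 ≤ A * R ^ (1 - 2 * ρ)) →
      (∃ D : ℝ, ∀ R : ℝ, 1 ≤ R → ∫ y in ball (0 : EuclideanSpace ℝ (Fin 3)) R, |P y| ≤ D * R ^ (1 - 2 * ρ)) →
      ∀ φ : EuclideanSpace ℝ (Fin 3) → EuclideanSpace ℝ (Fin 3), ContDiff ℝ 1 φ → HasCompactSupport φ →
        ∃ L C : ℝ, ∀ l : ℝ, 1 ≤ l → |l ^ (ρ - 2) * (∫ y, ⟪V y, φ (l⁻¹ • y)⟫) - L| ≤ C * l ^ (-(2 + ρ)) := by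
  intro P hprof hA hD φ hφ hφc
  have h2ρ : 0 < 2 + ρ := by linarith
  have hVc : Continuous V := hprof.contDiff_velocity.continuous
  have hPc : Continuous P := hprof.contDiff_pressure.continuous
  obtain ⟨B₀, B₁, r, hB₀, hB₁, hr, hφB, hDφB, hφ0, hDφ0⟩ := exists_bounds_of_vectorWeight hφ hφc
  obtain ⟨A, hA⟩ := hA
  obtain ⟨D, hD⟩ := hD
  set A' : ℝ := max A 0 with hA'def
  have hA'0 : 0 ≤ A' := le_max_right _ _
  set D' : ℝ := max D 0 with hD'def
  have hD'0 : 0 ≤ D' := le_max_right _ _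
  set r' : ℝ := max r 1 with hr'def
  have hr'1 : 1 ≤ r' := le_max_right _ _
  have hr'0 : 0 < r' := by linarith
  have hDφ0' : ∀ x, r' ≤ ‖x‖ → fderiv ℝ φ x = 0 := fun x hx => hDφ0 x (le_trans (le_max_left _ _) hx)
  -- a bound for the divergence of `φ`
  have hdivc : Continuous (VectorCalculus.divergence φ) := continuous_divergence (hφ.continuous_fderiv one_ne_zero)
  have hdivsupp : HasCompactSupport (VectorCalculus.divergence φ) := by
    refine (hφc.fderiv (𝕜 := ℝ)).mono fun x hx => ?_
    rw [mem_support] at hx ⊢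
    contrapose! hx
    exact divergence_eq_zero_of_fderiv_eq_zero hx
  obtain ⟨B₂, hB₂⟩ := hdivsupp.exists_bound_of_continuous hdivc
  have hB₂0 : 0 ≤ B₂ := (norm_nonneg _).trans (hB₂ 0)
  have hfar_of : ∀ {l : ℝ}, 0 < l → ∀ {y : EuclideanSpace ℝ (Fin 3)}, r' * l ≤ ‖y‖ → r' ≤ ‖l⁻¹ • y‖ := fun {l} hl {y} hy => by
    rw [norm_smul, norm_inv, Real.norm_eq_abs, abs_of_pos hl, le_inv_mul_iff₀ hl]; linarith
  -- the quadratic term: `|∫⟪V, Dφ(l⁻¹y)[V]⟫| ≤ B₁ A' (r'l)^{1−2ρ}`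
  have hK : ∀ l : ℝ, 1 ≤ l → |∫ y, ⟪V y, fderiv ℝ φ (l⁻¹ • y) (V y)⟫| ≤ B₁ * (A' * (r' * l) ^ (1 - 2 * ρ)) := by
    intro l hl
    have hl0 : 0 < l := by linarith
    have hint2 : IntegrableOn (fun y => ‖V y‖ ^ 2) (ball (0 : EuclideanSpace ℝ (Fin 3)) (r' * l)) :=
      ((hVc.norm.pow 2).continuousOn.integrableOn_compact (isCompact_closedBall (0 : EuclideanSpace ℝ (Fin 3)) (r' * l))).mono_set
        ball_subset_closedBall
    have hind : ∀ y, ‖⟪V y, fderiv ℝ φ (l⁻¹ • y) (V y)⟫‖ ≤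
        (ball (0 : EuclideanSpace ℝ (Fin 3)) (r' * l)).indicator (fun y => B₁ * ‖V y‖ ^ 2) y := by
      intro y
      by_cases hy : y ∈ ball (0 : EuclideanSpace ℝ (Fin 3)) (r' * l)
      · rw [indicator_of_mem hy]
        calc ‖⟪V y, fderiv ℝ φ (l⁻¹ • y) (V y)⟫‖ ≤ ‖V y‖ * ‖fderiv ℝ φ (l⁻¹ • y) (V y)‖ := norm_inner_le_norm _ _
          _ ≤ ‖V y‖ * (B₁ * ‖V y‖) := mul_le_mul_of_nonneg_left
              (((fderiv ℝ φ (l⁻¹ • y)).le_opNorm _).trans (mul_le_mul_of_nonneg_right (hDφB _) (norm_nonneg _))) (norm_nonneg _)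
          _ = B₁ * ‖V y‖ ^ 2 := by ring
      · rw [indicator_of_notMem hy]
        rw [mem_ball_zero_iff, not_lt] at hy
        rw [hDφ0' _ (hfar_of hl0 hy), zero_apply, inner_zero_right, norm_zero]
    calc |∫ y, ⟪V y, fderiv ℝ φ (l⁻¹ • y) (V y)⟫| = ‖∫ y, ⟪V y, fderiv ℝ φ (l⁻¹ • y) (V y)⟫‖ := (Real.norm_eq_abs _).symm
      _ ≤ ∫ y, (ball (0 : EuclideanSpace ℝ (Fin 3)) (r' * l)).indicator (fun y => B₁ * ‖V y‖ ^ 2) y :=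
          norm_integral_le_of_norm_le ((integrable_indicator_iff measurableSet_ball).2 (hint2.const_mul B₁)) (ae_of_all _ hind)
      _ = B₁ * ∫ y in ball (0 : EuclideanSpace ℝ (Fin 3)) (r' * l), ‖V y‖ ^ 2 := by
          rw [integral_indicator measurableSet_ball, integral_const_mul]
      _ ≤ B₁ * (A' * (r' * l) ^ (1 - 2 * ρ)) := by
          refine mul_le_mul_of_nonneg_left ?_ hB₁
          have hrl : 1 ≤ r' * l := by nlinarith
          exact (hA (r' * l) hrl).trans (mul_le_mul_of_nonneg_right (le_max_left _ _) (Real.rpow_nonneg (by positivity) _))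
  -- the pressure term: `|∫ P·div φ(l⁻¹y)| ≤ B₂ D' (r'l)^{1−2ρ}`
  have hPr : ∀ l : ℝ, 1 ≤ l → |∫ y, P y * VectorCalculus.divergence φ (l⁻¹ • y)| ≤ B₂ * (D' * (r' * l) ^ (1 - 2 * ρ)) := by
    intro l hl
    have hl0 : 0 < l := by linarith
    have hintP : IntegrableOn (fun y => |P y|) (ball (0 : EuclideanSpace ℝ (Fin 3)) (r' * l)) :=
      (hPc.abs.continuousOn.integrableOn_compact (isCompact_closedBall (0 : EuclideanSpace ℝ (Fin 3)) (r' * l))).mono_set ball_subset_closedBall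
    have hind : ∀ y, ‖P y * VectorCalculus.divergence φ (l⁻¹ • y)‖ ≤
        (ball (0 : EuclideanSpace ℝ (Fin 3)) (r' * l)).indicator (fun y => B₂ * |P y|) y := by
      intro y
      by_cases hy : y ∈ ball (0 : EuclideanSpace ℝ (Fin 3)) (r' * l)
      · rw [indicator_of_mem hy, Real.norm_eq_abs, abs_mul]
        have hb : |VectorCalculus.divergence φ (l⁻¹ • y)| ≤ B₂ := by
          have := hB₂ (l⁻¹ • y); rwa [Real.norm_eq_abs] at this
        calc |P y| * |VectorCalculus.divergence φ (l⁻¹ • y)| ≤ |P y| * B₂ := mul_le_mul_of_nonneg_left hb (abs_nonneg _)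
          _ = B₂ * |P y| := mul_comm _ _
      · rw [indicator_of_notMem hy]
        rw [mem_ball_zero_iff, not_lt] at hy
        rw [divergence_eq_zero_of_fderiv_eq_zero (hDφ0' _ (hfar_of hl0 hy)), mul_zero, norm_zero]
    calc |∫ y, P y * VectorCalculus.divergence φ (l⁻¹ • y)| = ‖∫ y, P y * VectorCalculus.divergence φ (l⁻¹ • y)‖ := (Real.norm_eq_abs _).symm
      _ ≤ ∫ y, (ball (0 : EuclideanSpace ℝ (Fin 3)) (r' * l)).indicator (fun y => B₂ * |P y|) y :=
          norm_integral_le_of_norm_le ((integrable_indicator_iff measurableSet_ball).2 (hintP.const_mul B₂)) (ae_of_all _ hind)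
      _ = B₂ * ∫ y in ball (0 : EuclideanSpace ℝ (Fin 3)) (r' * l), |P y| := by
          rw [integral_indicator measurableSet_ball, integral_const_mul]
      _ ≤ B₂ * (D' * (r' * l) ^ (1 - 2 * ρ)) := by
          refine mul_le_mul_of_nonneg_left ?_ hB₂0
          have hrl : 1 ≤ r' * l := by nlinarith
          exact (hD (r' * l) hrl).trans (mul_le_mul_of_nonneg_right (le_max_left _ _) (Real.rpow_nonneg (by positivity) _))
  -- the derivative bound
  set K₀ : ℝ := (2 + ρ) * (B₁ * A' + B₂ * D') * r' ^ (1 - 2 * ρ) with hK₀def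
  have hK₀ : 0 ≤ K₀ := by positivity
  have hderiv : ∀ l : ℝ, 0 < l → HasDerivAt (fun l' : ℝ => l' ^ (ρ - 2) * ∫ y, ⟪V y, φ (l'⁻¹ • y)⟫)
      ((2 + ρ) * l ^ (ρ - 4) *
        ∫ z, (⟪V z, fderiv ℝ φ (l⁻¹ • z) (V z)⟫ + P z * VectorCalculus.divergence φ (l⁻¹ • z))) l :=
    fun l hl => traceDerivativeIdentity h2ρ.ne' V P hprof φ hφ hφc l hl
  -- split the integral of the sum (both pieces integrable: continuous with compact support)
  have hsplit : ∀ l : ℝ, 0 < l → ∫ z, (⟪V z, fderiv ℝ φ (l⁻¹ • z) (V z)⟫ + P z * VectorCalculus.divergence φ (l⁻¹ • z)) =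
      (∫ z, ⟪V z, fderiv ℝ φ (l⁻¹ • z) (V z)⟫) + ∫ z, P z * VectorCalculus.divergence φ (l⁻¹ • z) := by
    intro l hl
    have hDφc : Continuous (fderiv ℝ φ) := hφ.continuous_fderiv one_ne_zero
    have hsm : Continuous fun y : EuclideanSpace ℝ (Fin 3) => l⁻¹ • y := continuous_const_smul l⁻¹
    have hcs : ∀ {f : EuclideanSpace ℝ (Fin 3) → ℝ}, Continuous f → (∀ y, r' * l < ‖y‖ → f y = 0) → Integrable f := by
      intro f hf hf0
      refine hf.integrable_of_hasCompactSupport (HasCompactSupport.of_support_subset_isCompact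
        (isCompact_closedBall (0 : EuclideanSpace ℝ (Fin 3)) (r' * l)) fun y hy => ?_)
      rw [mem_closedBall, dist_zero_right]
      by_contra hcon
      exact hy (hf0 y (not_le.1 hcon))
    refine integral_add (hcs (hVc.inner ((hDφc.comp hsm).clm_apply hVc)) fun y hy => ?_) (hcs (hPc.mul (hdivc.comp hsm)) fun y hy => ?_)
    · rw [hDφ0' _ (hfar_of hl hy.le), zero_apply, inner_zero_right]
    · rw [divergence_eq_zero_of_fderiv_eq_zero (hDφ0' _ (hfar_of hl hy.le)), mul_zero]
  have hbd : ∀ l : ℝ, 1 ≤ l → |(2 + ρ) * l ^ (ρ - 4) *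
      ∫ z, (⟪V z, fderiv ℝ φ (l⁻¹ • z) (V z)⟫ + P z * VectorCalculus.divergence φ (l⁻¹ • z))| ≤ K₀ * l ^ (-1 - (2 + ρ)) := by
    intro l hl
    have hl0 : 0 < l := by linarith
    rw [hsplit l hl0, abs_mul, abs_mul, abs_of_pos h2ρ, abs_of_pos (Real.rpow_pos_of_pos hl0 _)]
    have hsum : |(∫ z, ⟪V z, fderiv ℝ φ (l⁻¹ • z) (V z)⟫) + ∫ z, P z * VectorCalculus.divergence φ (l⁻¹ • z)| ≤
        (B₁ * A' + B₂ * D') * (r' * l) ^ (1 - 2 * ρ) := by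
      calc |(∫ z, ⟪V z, fderiv ℝ φ (l⁻¹ • z) (V z)⟫) + ∫ z, P z * VectorCalculus.divergence φ (l⁻¹ • z)|
          ≤ |∫ z, ⟪V z, fderiv ℝ φ (l⁻¹ • z) (V z)⟫| + |∫ z, P z * VectorCalculus.divergence φ (l⁻¹ • z)| := abs_add_le _ _
        _ ≤ B₁ * (A' * (r' * l) ^ (1 - 2 * ρ)) + B₂ * (D' * (r' * l) ^ (1 - 2 * ρ)) := add_le_add (hK l hl) (hPr l hl)
        _ = (B₁ * A' + B₂ * D') * (r' * l) ^ (1 - 2 * ρ) := by ring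
    calc (2 + ρ) * l ^ (ρ - 4) * |(∫ z, ⟪V z, fderiv ℝ φ (l⁻¹ • z) (V z)⟫) + ∫ z, P z * VectorCalculus.divergence φ (l⁻¹ • z)|
        ≤ (2 + ρ) * l ^ (ρ - 4) * ((B₁ * A' + B₂ * D') * (r' * l) ^ (1 - 2 * ρ)) :=
          mul_le_mul_of_nonneg_left hsum (by positivity)
      _ = K₀ * l ^ (-1 - (2 + ρ)) := by
          rw [hK₀def, Real.mul_rpow hr'0.le hl0.le]
          have e : l ^ (ρ - 4) * l ^ (1 - 2 * ρ) = l ^ (-1 - (2 + ρ)) := by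
            rw [← Real.rpow_add hl0]; congr 1; ring
          calc (2 + ρ) * l ^ (ρ - 4) * ((B₁ * A' + B₂ * D') * (r' ^ (1 - 2 * ρ) * l ^ (1 - 2 * ρ)))
              = (2 + ρ) * (B₁ * A' + B₂ * D') * r' ^ (1 - 2 * ρ) * (l ^ (ρ - 4) * l ^ (1 - 2 * ρ)) := by ring
            _ = (2 + ρ) * (B₁ * A' + B₂ * D') * r' ^ (1 - 2 * ρ) * l ^ (-1 - (2 + ρ)) := by rw [e]
  obtain ⟨L, hL⟩ := TwoSidedMoment.exists_limit_of_deriv_bound h2ρ hK₀ hderiv hbd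
  exact ⟨L, K₀ / (2 + ρ), fun l hl => hL l hl⟩

end WeakTrace

end Summit.NavierStokesRegularity.NavierStokesRegularity.Theorems.PowerGaugeEulerLiouville

end
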